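import Summits.BirchSwinnertonDyer.Rank1Residual.GaloisImage.KolyvaginStalkFunctionals
import Summits.BirchSwinnertonDyer.Rank1Residual.GaloisImage.StarkVolumeCross
import HarnessLib

/-!
# A generating Kolyvagin system at core rank one over `𝔽_p`, from compatible volume forms on the
# relaxed Selmer groups (cell `b2b-bsdres`, team n1011, ROUTE-1 item R1-56 "S24(1) @ m = 1 in the
# kernel", row T-R1-56-S, FILE D2 = K4 EXISTENCE, the volume system)

HONEST FRAMING (verbatim for the cell): research route; prove what is provable now; no claim beyond
stated classes; nothing booked; no mark / label moved.  TOOL constructions and theorems about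
Kolyvagin systems of a finite Galois module at the residual level `m = 1`; no named fact, no
conjecture node.  Setting = p11's R1-16 files + FILE A `KolyvaginStalkLevels` + FILE D1
`KolyvaginStalkFunctionals`; the `𝔽_p`-structure on `H¹(K, M)` is an instance argument.

## What (Mazur–Rubin, JTNB 28 (2016) §6 "Stark systems" and §8 at rank one over a field)

Fix a CORE-LIKE base level `N₀` (`H¹_{(𝓕^{N₀})^*}(K, M^D) = 0`) and a volume form `ε₀` on
`W(N₀) = H¹_{𝓕^{N₀}}(K, M)` (`VolumeForm.volOn`, FILE C).  For every level `N ⊇ N₀` that is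
core-like (e.g. `N = n ∪ N₀` for any level `n`), `#W(N) = p^{#N+1}` (FILE A), and the contraction of
volume forms along `N₀ ⊆ N` freezing the slots of `N ∖ N₀` at the transverse functionals `t_𝔮`
(FILE D1) is a bijection between the two lines of volume forms (FILE C); `vol N` is THE volume form
on `W(N)` contracting to `ε₀` (`vol_mem_volOn`, `contract_vol`), and these are compatible along
every inclusion of core-like levels (`contract_vol_vol` — Mazur–Rubin Def. 6.1/6.3: a Stark system
of rank one).  The Kolyvagin system they define (`kappa`, FILE D3 `KolyvaginStalkKappa.lean`):
`κ_n := (−1)^{#n} · cross_{W(n ∪ N₀)} (vol (n ∪ N₀)) (f_𝔮 on n, t_𝔮 off n)`.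
This file: the level-inclusion bookkeeping (`levelIncl`), the hypotheses of the contraction between
levels (`tFun_frozen_eq_zero`, `mem_Wsub_of_frozen`), the volume system `vol` and its two
properties, and the base data (`exists_base`: a core-like `N₀` with a non-zero volume form).

References: B. Mazur, K. Rubin, JTNB 28 (2016) 145–183 (arXiv:1312.4052) Def. 6.1, Prop. 6.2,
Def. 6.3, Lemma 6.4, Thm. 6.5 (read 2026-08-21, held).
-/

noncomputable section

open scoped Classical NumberField ContRepresentation
open Function NumberField IsDedekindDomain
open Literature.NumberTheory.GaloisRepresentations Literature.NumberTheory.GaloisRepresentations.DiscreteGaloisModule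
  Literature.NumberTheory.GaloisCohomology
open Summit.BirchSwinnertonDyer.Rank1Residual.GaloisImage.CoreRankZero
open Summit.BirchSwinnertonDyer.Rank1Residual.GaloisImage.VolumeForm

universe u

namespace Summit.BirchSwinnertonDyer.Rank1Residual.GaloisImage.CoreRankOne.Stalk

variable {K : Type u} [Field K] [NumberField K]
variable {M : Type u} [AddCommGroup M] [TopologicalSpace M] [DiscreteTopology M] [Finite M]
variable {ρ : DiscreteGaloisModule K M} (p : ℕ) [Fact p.Prime] [Module (ZMod p) (galoisCohomology ρ 1)]

/-! ## §1. Inclusions of level index types and the frozen transverse functionals -/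

section Incl

/-- The inclusion `↥N → ↥N′` of the index types of two levels `N ⊆ N′`. [folklore] -/
def levelIncl {N N' : Finset (HeightOneSpectrum (𝓞 K))} (h : N ⊆ N') : ↥N → ↥N' :=
  fun x => ⟨x.1, h x.2⟩

omit [NumberField K] [Finite M] [Fact p.Prime] [Module (ZMod p) (galoisCohomology ρ 1)] in
/-- `levelIncl` is injective. [folklore] -/
theorem levelIncl_injective {N N' : Finset (HeightOneSpectrum (𝓞 K))} (h : N ⊆ N') :
    Injective (levelIncl (K := K) h) := by
  intro x y hxy
  have h1 : (levelIncl (K := K) h x).1 = (levelIncl (K := K) h y).1 := by rw [hxy]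
  exact Subtype.ext h1

omit [NumberField K] [Finite M] [Fact p.Prime] [Module (ZMod p) (galoisCohomology ρ 1)] in
/-- A slot of `N′` off the range of `levelIncl` is a prime of `N′ ∖ N`. [folklore] -/
theorem not_mem_of_not_mem_range_levelIncl {N N' : Finset (HeightOneSpectrum (𝓞 K))} (h : N ⊆ N')
    {b : ↥N'} (hb : b ∉ Set.range (levelIncl (K := K) h)) : b.1 ∉ N :=
  fun hbN => hb ⟨⟨b.1, hbN⟩, Subtype.ext rfl⟩

variable (ρ) in
/-- The frozen transverse functionals at a level: `𝔮 ↦ t_𝔮`. [folklore] -/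
abbrev tFamily (N : Finset (HeightOneSpectrum (𝓞 K))) : ↥N → Module.Dual (ZMod p) (galoisCohomology ρ 1) :=
  fun ℓ => tFun ρ p ℓ.1

omit [Finite M] in
/-- The frozen transverse functionals of `N′ ∖ N` kill `W(N)`. [folklore] -/
theorem tFun_frozen_eq_zero {S : Finset (Place K)} {𝓕 : SelmerStructure ρ}
    (h𝓕 : 𝓕.IsUnramifiedOutside S) {D : KolyvaginDatum ρ} (hPS : ∀ q ∈ D.primes, (Sum.inr q : Place K) ∉ S)
    (hSQ : ∀ q ∈ D.primes, Nat.card (SingularQuotient (GaloisRep.toLocal q ρ)) = p)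
    {N N' : Finset (HeightOneSpectrum (𝓞 K))} (h : N ⊆ N') (hN' : D.IsLevel N') :
    ∀ b : ↥N', b ∉ Set.range (levelIncl (K := K) h) →
      ∀ w ∈ Wsub p 𝓕 N, tFamily ρ p N' b w = 0 :=
  fun b hb _ hw => tFun_apply_eq_zero_of_mem_Wsub p h𝓕 hPS hSQ (hN' b.2)
    (not_mem_of_not_mem_range_levelIncl h hb) hw

omit [Finite M] in
/-- A class of `W(N′)` killed by the frozen functionals of `N′ ∖ N` lies in `W(N)`. [folklore] -/
theorem mem_Wsub_of_frozen {S : Finset (Place K)} {𝓕 : SelmerStructure ρ}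
    (h𝓕 : 𝓕.IsUnramifiedOutside S) {D : KolyvaginDatum ρ} (hPS : ∀ q ∈ D.primes, (Sum.inr q : Place K) ∉ S)
    (hSQ : ∀ q ∈ D.primes, Nat.card (SingularQuotient (GaloisRep.toLocal q ρ)) = p)
    {N N' : Finset (HeightOneSpectrum (𝓞 K))} (h : N ⊆ N') (hN' : D.IsLevel N') :
    ∀ v ∈ Wsub p 𝓕 N', (∀ b : ↥N', b ∉ Set.range (levelIncl (K := K) h) → tFamily ρ p N' b v = 0) →
      v ∈ Wsub p 𝓕 N :=
  fun _ hv hv' => mem_Wsub_of_forall_tFun_eq_zero p h𝓕 hPS hSQ hN' hv fun q hqN' hqN =>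
    hv' ⟨q, hqN'⟩ (by
      rintro ⟨x, hx⟩
      have h1 : (levelIncl (K := K) h x).1 = q := by rw [hx]
      exact hqN (h1 ▸ x.2))

end Incl

/-! ## §2. The volume system on the core-like levels above `N₀` -/

section Vol

variable (𝓕 : SelmerStructure ρ) (N₀ : Finset (HeightOneSpectrum (𝓞 K)))
  (ε₀ : (Module.Dual (ZMod p) (galoisCohomology ρ 1)) [⋀^Option ↥N₀]→ₗ[ZMod p] ZMod p)

/-- **The volume form at a level `N ⊇ N₀`**: THE volume form on `W(N)` contracting to `ε₀` along
`N₀ ⊆ N` (frozen at the transverse functionals), when one exists; `0` otherwise (Mazur–Rubin's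
Stark system `ε` of rank one, JTNB 28 (2016) Def. 6.3, determined by its bottom value).
[folklore] -/
def vol (N : Finset (HeightOneSpectrum (𝓞 K))) :
    (Module.Dual (ZMod p) (galoisCohomology ρ 1)) [⋀^Option ↥N]→ₗ[ZMod p] ZMod p :=
  if h : ∃ hs : N₀ ⊆ N, ∃ ω ∈ volOn (Option ↥N) (Wsub p 𝓕 N),
      contract ω (levelIncl_injective hs) (tFamily ρ p N) = ε₀
  then h.choose_spec.choose else 0

variable {𝓕 N₀ ε₀}

omit [Finite M] in
/-- The defining property of `vol N` whenever some volume form on `W(N)` contracts to `ε₀`.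
[folklore] -/
theorem vol_spec {N : Finset (HeightOneSpectrum (𝓞 K))} (hs : N₀ ⊆ N)
    (hex : ∃ ω ∈ volOn (Option ↥N) (Wsub p 𝓕 N), contract ω (levelIncl_injective hs) (tFamily ρ p N) = ε₀) :
    vol p 𝓕 N₀ ε₀ N ∈ volOn (Option ↥N) (Wsub p 𝓕 N) ∧
      contract (vol p 𝓕 N₀ ε₀ N) (levelIncl_injective hs) (tFamily ρ p N) = ε₀ := by
  have h : ∃ hs : N₀ ⊆ N, ∃ ω ∈ volOn (Option ↥N) (Wsub p 𝓕 N),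
      contract ω (levelIncl_injective hs) (tFamily ρ p N) = ε₀ := ⟨hs, hex⟩
  rw [vol, dif_pos h]
  exact h.choose_spec.choose_spec

variable {S : Finset (Place K)} {inv : LocalInvariants K p} {D : KolyvaginDatum ρ}

/-- **Existence at every core-like level above `N₀`**: if `ε₀` is a volume form on `W(N₀)` and
`N₀ ⊆ N` are core-like levels at core rank one (`#W = p^{#·+1}`), some volume form on `W(N)`
contracts to `ε₀` (FILE C `exists_contract_eq`), so `vol N` is a volume form on `W(N)` with
`contract (vol N) = ε₀`. [folklore] -/
theorem vol_mem_volOn_and_contract_vol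
    (h𝓕 : 𝓕.IsUnramifiedOutside S) (hfin : Finite 𝓕.selmerGroup)
    (hPS : ∀ q ∈ D.primes, (Sum.inr q : Place K) ∉ S)
    (hSQ : ∀ q ∈ D.primes, Nat.card (SingularQuotient (GaloisRep.toLocal q ρ)) = p)
    (hε₀ : ε₀ ∈ volOn (Option ↥N₀) (Wsub p 𝓕 N₀))
    (hW₀ : Nat.card (𝓕.relaxedAt N₀).selmerGroup = p ^ (N₀.card + 1))
    {N : Finset (HeightOneSpectrum (𝓞 K))} (hs : N₀ ⊆ N) (hN : D.IsLevel N)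
    (hW : Nat.card (𝓕.relaxedAt N).selmerGroup = p ^ (N.card + 1)) :
    vol p 𝓕 N₀ ε₀ N ∈ volOn (Option ↥N) (Wsub p 𝓕 N) ∧
      contract (vol p 𝓕 N₀ ε₀ N) (levelIncl_injective hs) (tFamily ρ p N) = ε₀ := by
  haveI := hfin
  refine vol_spec p hs (exists_contract_eq (levelIncl_injective hs) (tFamily ρ p N)
    (Wsub_mono p 𝓕 hs) (tFun_frozen_eq_zero p h𝓕 hPS hSQ hs hN) (mem_Wsub_of_frozen p h𝓕 hPS hSQ hs hN)
    (card_option_eq_finrank_Wsub p 𝓕 hW) (card_option_eq_finrank_Wsub p 𝓕 hW₀) hε₀)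

/-- **Compatibility of the volume system** (Mazur–Rubin Prop. 6.2 / Def. 6.3): for core-like levels
`N₀ ⊆ N ⊆ N′`, contracting `vol N′` along `N ⊆ N′` gives `vol N` — both are volume forms on `W(N)`
with the same contraction `ε₀` to `N₀`, and that contraction is injective. [folklore] -/
theorem contract_vol_vol
    (h𝓕 : 𝓕.IsUnramifiedOutside S) (hfin : Finite 𝓕.selmerGroup)
    (hPS : ∀ q ∈ D.primes, (Sum.inr q : Place K) ∉ S)
    (hSQ : ∀ q ∈ D.primes, Nat.card (SingularQuotient (GaloisRep.toLocal q ρ)) = p)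
    (hε₀ : ε₀ ∈ volOn (Option ↥N₀) (Wsub p 𝓕 N₀))
    (hW₀ : Nat.card (𝓕.relaxedAt N₀).selmerGroup = p ^ (N₀.card + 1))
    {N N' : Finset (HeightOneSpectrum (𝓞 K))} (hs : N₀ ⊆ N) (hNN' : N ⊆ N') (hN : D.IsLevel N)
    (hN' : D.IsLevel N') (hW : Nat.card (𝓕.relaxedAt N).selmerGroup = p ^ (N.card + 1))
    (hW' : Nat.card (𝓕.relaxedAt N').selmerGroup = p ^ (N'.card + 1)) :
    contract (vol p 𝓕 N₀ ε₀ N') (levelIncl_injective hNN') (tFamily ρ p N') = vol p 𝓕 N₀ ε₀ N := by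
  haveI := hfin
  obtain ⟨hvN, hcN⟩ := vol_mem_volOn_and_contract_vol p h𝓕 hfin hPS hSQ hε₀ hW₀ hs hN hW
  obtain ⟨hvN', hcN'⟩ :=
    vol_mem_volOn_and_contract_vol p h𝓕 hfin hPS hSQ hε₀ hW₀ (hs.trans hNN') hN' hW'
  -- both sides are volume forms on `W(N)` …
  have hL : contract (vol p 𝓕 N₀ ε₀ N') (levelIncl_injective hNN') (tFamily ρ p N') ∈
      volOn (Option ↥N) (Wsub p 𝓕 N) :=
    contract_mem_volOn hvN' (levelIncl_injective hNN') _ (mem_Wsub_of_frozen p h𝓕 hPS hSQ hNN' hN')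
  -- … with the same contraction to `N₀`
  refine contract_injOn hL hvN (levelIncl_injective hs) (tFamily ρ p N) (Wsub_mono p 𝓕 hs)
    (tFun_frozen_eq_zero p h𝓕 hPS hSQ hs hN) (mem_Wsub_of_frozen p h𝓕 hPS hSQ hs hN)
    (card_option_eq_finrank_Wsub p 𝓕 hW) (card_option_eq_finrank_Wsub p 𝓕 hW₀) ?_
  rw [hcN, show tFamily ρ p N = tFamily ρ p N' ∘ levelIncl hNN' from rfl, contract_contract]
  exact hcN'

/-- `vol N ≠ 0` at a core-like level `N ⊇ N₀` when `ε₀ ≠ 0`. [folklore] -/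
theorem vol_ne_zero
    (h𝓕 : 𝓕.IsUnramifiedOutside S) (hfin : Finite 𝓕.selmerGroup)
    (hPS : ∀ q ∈ D.primes, (Sum.inr q : Place K) ∉ S)
    (hSQ : ∀ q ∈ D.primes, Nat.card (SingularQuotient (GaloisRep.toLocal q ρ)) = p)
    (hε₀ : ε₀ ∈ volOn (Option ↥N₀) (Wsub p 𝓕 N₀)) (hε₀0 : ε₀ ≠ 0)
    (hW₀ : Nat.card (𝓕.relaxedAt N₀).selmerGroup = p ^ (N₀.card + 1))
    {N : Finset (HeightOneSpectrum (𝓞 K))} (hs : N₀ ⊆ N) (hN : D.IsLevel N)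
    (hW : Nat.card (𝓕.relaxedAt N).selmerGroup = p ^ (N.card + 1)) :
    vol p 𝓕 N₀ ε₀ N ≠ 0 := by
  intro h0
  have h := (vol_mem_volOn_and_contract_vol p h𝓕 hfin hPS hSQ hε₀ hW₀ hs hN hW).2
  rw [h0, contract, restrictSlots_zero] at h
  exact hε₀0 h.symm

end Vol

/-! ## §3. The base data: a core-like level `N₀` and a non-zero volume form on `W(N₀)` -/

section Base

variable {S : Finset (Place K)} {inv : LocalInvariants K p} {𝓕 : SelmerStructure ρ} {D : KolyvaginDatum ρ}

/-- **The base of the volume system exists**: there is a core-like level `N₀` (FILE A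
`exists_coreLike_superset` above `∅`), and on `W(N₀)` — of dimension `#N₀ + 1` at core rank one — a
non-zero volume form (`VolumeForm.volOf` of a basis). [folklore] -/
theorem exists_base (hperf : inv.IsPerfect) (hsum : inv.SumLocalTermEqZero) (hcompl : inv.SelmerComplement)
    (hM : ∀ m : M, p • m = 0)
    (hS : ∀ v : HeightOneSpectrum (𝓞 K), (Sum.inr v : Place K) ∉ S →
      ((p : ℕ) : 𝓞 K) ∉ v.asIdeal ∧ GaloisRep.IsUnramifiedAt v ρ)
    (h𝓕 : 𝓕.IsUnramifiedOutside S) (hfin : Finite 𝓕.selmerGroup)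
    (hfind : Finite (inv.dualSelmerStructure ρ 𝓕).selmerGroup)
    (hχ : LocalInvariants.HasCoreRank inv 𝓕 p 1)
    (hPS : ∀ q ∈ D.primes, (Sum.inr q : Place K) ∉ S)
    (hU : ∀ q ∈ D.primes, Nat.card (unramifiedSubgroup (GaloisRep.toLocal q ρ) 1) = p)
    (hH1 : ∀ q ∈ D.primes, Nat.card (galoisCohomology (GaloisRep.toLocal q ρ) 1) = p ^ 2)
    (hprime' : ∀ y : galoisCohomology (ρ.tateDual p) 1, y ≠ 0 →
      {q ∈ D.primes | galoisCohomology.localization (ρ.tateDual p) (Sum.inr q) 1 y ≠ 0}.Infinite) :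
    ∃ (N₀ : Finset (HeightOneSpectrum (𝓞 K)))
      (ε₀ : (Module.Dual (ZMod p) (galoisCohomology ρ 1)) [⋀^Option ↥N₀]→ₗ[ZMod p] ZMod p),
      D.IsLevel N₀ ∧ (inv.dualSelmerStructure ρ (𝓕.relaxedAt N₀)).selmerGroup = ⊥ ∧
        ε₀ ∈ volOn (Option ↥N₀) (Wsub p 𝓕 N₀) ∧ ε₀ ≠ 0 := by
  haveI := hfin
  obtain ⟨N₀, -, hN₀, hcore⟩ :=
    exists_coreLike_superset hperf hM 𝓕 hfind D hprime' D.isLevel_empty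
  have hW₀ : Nat.card (𝓕.relaxedAt N₀).selmerGroup = p ^ (N₀.card + 1) := by
    rw [natCard_selmerGroup_relaxedAt_eq_pow_mul hperf hsum hcompl hM hS h𝓕 hfin hfind hχ hPS hU hH1 hN₀,
      hcore, AddSubgroup.card_bot, mul_one]
  have hdim := card_option_eq_finrank_Wsub p 𝓕 hW₀
  let b : Module.Basis (Option ↥N₀) (ZMod p) (Wsub p 𝓕 N₀) :=
    (Module.finBasisOfFinrankEq (ZMod p) (Wsub p 𝓕 N₀) hdim.symm).reindex
      (Fintype.equivFinOfCardEq rfl).symm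
  exact ⟨N₀, volOf b, hN₀, hcore, volOf_mem_volOn b, volOf_ne_zero b⟩

end Base

end Summit.BirchSwinnertonDyer.Rank1Residual.GaloisImage.CoreRankOne.Stalk

end
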